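import Summits.HodgeConjecture.HodgeConjecture.Theorems.PadicSemiregularLiftHodgeFermatVarietiesSigmaSevenOfFibre
import HarnessLib

/-!
# Hodge multisets of `p + 1` elements: `p − 1` points of a `p`-progression force Aoki's `σ_{p,A}` (every odd prime `p ≥ 5`) — stub GP-L3 `stub_sigmaStd_of_fibre` of line `cancel-by-any-claim-lattice`, crux `HodgeFermatVarieties` (stmt-HodgeConjecture-1334)

Crux `HodgeFermatVarieties` (stmt-HodgeConjecture-1334), line `cancel-by-any-claim-lattice`, stub GP-L3
`stub_sigmaStd_of_fibre` (worker file). Everything here is PROVED (no `sorry`, no new definition, no new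
named fact). This is the file `…SigmaSevenOfFibre` (itself `…SigmaFiveOfFibre` with `5 ↦ 7`) with `7`
replaced by a general odd prime `p₁ ≥ 5`; it reuses the bookkeeping of `…SigmaFiveOfFibre`
(`CoprimeSix.isHodgeMultiset_map_neg`, `CoprimeSix.exists_pairing_of_four`).

The lead's programme GP ("Aoki's Theorem A one prime down, for every prime `p₁ ≥ 5`") classifies the
Hodge multisets `s` of `p₁ + 1` elements of `ℤ/m`, all primes of `m` at least `p₁`: pairs, or Aoki's
standard element `σ_{p₁,A} = {A + j·e : j < p₁} + {-p₁A}`, `e = m/p₁`, `p₁A ≠ 0`. A level analysis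
(stub GP-L2) produces all but one (`j₀`) of the `p₁` progression points `A + j e` inside `s`; THIS file
finishes:

* `eq_sigmaStd_of_fibre` (abstract form, any `p`): a Hodge multiset `s` of `p + 1` elements at a level
  `m` with `(m, 6) = 1 = (p - 1, m)`, containing `A + j e` for `j < p`, `j ≠ j₀` (`pA ≠ 0`, `pe = 0`, the
  progression without repetition, `σ = {A + j e} + {-pA}` Hodge), equals `σ`.
* `stub_sigmaStd_of_fibre` (registered signature): for a prime `p₁ ≥ 5`, a level `m` all of whose prime
  factors are `≥ p₁`, `p₁ ∣ m`, a Hodge multiset `s` of `p₁ + 1` elements containing the points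
  `A + j(m/p₁)`, `j < p₁`, `j ≠ j₀` (`p₁A ≠ 0`) is a juxtaposition of pairs or
  `s = {A + j(m/p₁) : j < p₁} + {-p₁A}` (in fact always the latter).

Proof. The standard multiset `σ = {A + j e : j < p₁} + {-p₁A}` is a Hodge multiset
(`isHodgeMultiset_pStandard`, Aoki 1983 Prop. 5.1 with `p₁ = 2r + 1`), hence so is its negative
(`isHodgeMultiset_map_neg`) and `s + (-σ)` (a Hodge multiset of `2p₁ + 2` elements). The `p₁ - 1`
progression points `F ⊂ s` are pairwise distinct (the progression is the fibre of reduction mod `m/p₁`,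
`range_map_eq_filter_of_dvd_one`), so `s = F + {u₁, u₂}` and
`s + (-σ) = (F + (-F)) + {u₁, u₂, -(A + j₀ e), p₁A}`; cancelling the pairs (`isHodgeMultiset_add_map_neg`,
`IsHodgeMultiset.of_add_left`) leaves a Hodge QUADRUPLE, which by the surface theorem of Aoki–Shioda 1983
(`(𝔅²ₘ) (i)`, `(m, 6) = 1` — every prime of `m` is `≥ p₁ ≥ 5` — DISCHARGED in the tree:
`AokiShioda1983_thmB2m_coprime_six_holds`) splits into two pairs (`exists_pairing_of_four`). If
`-(A + j₀ e)` pairs with `p₁A` then `p₁A = A + j₀ e`, so `(p₁ - 1) p₁ A = p₁ j₀ e = 0` and `p₁A = 0`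
(`p₁ - 1` is a unit mod `m`: each of its prime factors is `< p₁`, each prime factor of `m` is `≥ p₁`) —
excluded; otherwise `{u₁, u₂} = {A + j₀ e, -p₁A}` and `s = σ`. In particular the LEFT disjunct of the
registered conclusion never occurs under the hypotheses; it is kept because the signature is registered
verbatim.

References: [AokiShioda1983] N. Aoki, T. Shioda, Generators of the Néron–Severi group of a Fermat surface,
Progr. Math. 35 (1983), §2 Theorem (𝔅²ₘ) (i); [Aoki1983] N. Aoki, Math. Ann. 266 (1983) §5 Prop. 5.1, §7
Thm. A′; [Aoki1987] N. Aoki, J. Math. Soc. Japan 39 (1987) §1 p. 387; [Shioda1979PJA] T. Shioda, Proc. Japan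
Acad. 55A (1979) §1.
-/

-- D-0017: single-problem summit, `Summit.HodgeConjecture.HodgeConjecture.…` repeats the component by design.
set_option linter.dupNamespace false

noncomputable section

open Finset
open Literature.AlgebraicGeometry.HodgeTheory Literature.AlgebraicGeometry.HodgeTheory.FermatCharacter

namespace Summit.HodgeConjecture.HodgeConjecture.Theorems.CancelByAnyClaimLattice.CoprimeSix

/-! ### The core: `p - 1` progression points force `σ_{p,A}` -/

/-- **`p - 1` points of a `p`-progression force `σ_{p,A}`, abstract form.** Let `s` be a Hodge multiset of
`p + 1` elements of level `m`, `(m, 6) = 1`, `(p - 1, m) = 1`, and `A, e ∈ ℤ/m` with `pA ≠ 0`, `pe = 0`,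
such that the progression `{A + i e : i < p}` has no repetition and `σ = {A + i e : i < p} + {-pA}` is a
Hodge multiset. If `A + j e ∈ s` for all `j < p`, `j ≠ j₀`, then `s = σ`: `s + (-σ)` minus the `p - 1` pairs
`{A + je, -(A + je)}` is a Hodge quadruple `{u₁, u₂, -(A + j₀ e), pA}`, two pairs by Aoki–Shioda;
`pA = A + j₀ e` would give `(p - 1) pA = p j₀ e = 0`, i.e. `pA = 0` as `p - 1` is a unit, so
`{u₁, u₂} = {A + j₀ e, -pA}`. [cite: Aoki1983, §5 Prop. 5.1 and §7 Thm. A′]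
[cite: AokiShioda1983, §2 Theorem (𝔅²ₘ) (i)] -/
theorem eq_sigmaStd_of_fibre {m : ℕ} [NeZero m] (hm : m.Coprime 6) {p : ℕ} (hp1 : (p - 1).Coprime m)
    {s : Multiset (ZMod m)} (hs : IsHodgeMultiset s) (hcard : Multiset.card s = p + 1) {A e : ZMod m}
    (hA : (p : ZMod m) * A ≠ 0) (hpe : (p : ZMod m) * e = 0)
    (hσ : IsHodgeMultiset ((Multiset.range p).map (fun i : ℕ ↦ A + (i : ZMod m) * e) + {-((p : ZMod m) * A)}))
    (hnd : ((Multiset.range p).map (fun i : ℕ ↦ A + (i : ZMod m) * e)).Nodup)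
    {j₀ : ℕ} (hj₀ : j₀ < p) (hfib : ∀ j : ℕ, j < p → j ≠ j₀ → A + (j : ZMod m) * e ∈ s) :
    s = (Multiset.range p).map (fun i : ℕ ↦ A + (i : ZMod m) * e) + {-((p : ZMod m) * A)} := by
  -- adapted from `eq_sigmaSeven_of_fibre` (…SigmaSevenOfFibre), `7 ↦ p`
  classical
  set f : ℕ → ZMod m := fun i ↦ A + (i : ZMod m) * e with hf
  have hfj : f j₀ = A + (j₀ : ZMod m) * e := by rw [hf]
  -- the `p - 1` progression points lying in `s`
  set F : Multiset (ZMod m) := ((Finset.range p).erase j₀).val.map f with hF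
  have hsplit : (Multiset.range p).map f = f j₀ ::ₘ F := by
    rw [hF, ← Multiset.map_cons f j₀, ← Finset.insert_val_of_notMem (Finset.notMem_erase j₀ _),
      Finset.insert_erase (Finset.mem_range.mpr hj₀), Finset.range_val]
  have hFnd : F.Nodup := by
    refine Multiset.nodup_of_le ?_ hnd
    rw [hsplit]
    exact Multiset.le_cons_self _ _
  have hFs : F ≤ s := by
    refine (Multiset.le_iff_subset hFnd).mpr fun x hx ↦ ?_
    obtain ⟨j, hj, rfl⟩ := Multiset.mem_map.mp hx
    rw [Finset.mem_val, Finset.mem_erase, Finset.mem_range] at hj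
    exact hfib j hj.2 hj.1
  obtain ⟨u, hsu⟩ := Multiset.le_iff_exists_add.mp hFs
  have hFcard : Multiset.card F = p - 1 := by
    rw [hF, Multiset.card_map, Finset.card_val, Finset.card_erase_of_mem (Finset.mem_range.mpr hj₀),
      Finset.card_range]
  have hucard : Multiset.card u = 2 := by
    have hc := congrArg Multiset.card hsu
    rw [Multiset.card_add, hFcard, hcard] at hc
    omega
  obtain ⟨u₁, u₂, rfl⟩ := Multiset.card_eq_two.mp hucard
  -- the Hodge quadruple `{u₁, u₂, -(f j₀), pA}`
  have hF0 : ∀ x ∈ F, x ≠ 0 := fun x hx ↦ hs.1.1 x (Multiset.mem_of_le hFs hx)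
  have hpairs : IsHodgeMultiset (F + F.map (fun a ↦ -a)) := isHodgeMultiset_add_map_neg hF0
  have hbig : IsHodgeMultiset (s + ((Multiset.range p).map f + {-((p : ZMod m) * A)}).map (fun a ↦ -a)) :=
    hs.add (isHodgeMultiset_map_neg hσ)
  have heq : s + ((Multiset.range p).map f + {-((p : ZMod m) * A)}).map (fun a ↦ -a) =
      (F + F.map (fun a ↦ -a)) + {u₁, u₂, -(f j₀), (p : ZMod m) * A} := by
    rw [hsu, hsplit]
    simp only [Multiset.map_add, Multiset.map_singleton, neg_neg, Multiset.insert_eq_cons,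
      ← Multiset.singleton_add]
    abel
  rw [heq] at hbig
  have ht : IsHodgeMultiset ({u₁, u₂, -(f j₀), (p : ZMod m) * A} : Multiset (ZMod m)) :=
    hbig.of_add_left hpairs
  -- the obstruction: `pA = A + j₀ e` is impossible (`(p - 1) · pA = p j₀ e = 0`, `p - 1` a unit)
  have hbad : -(f j₀) + (p : ZMod m) * A = 0 → False := by
    intro h
    have hu : IsUnit ((p - 1 : ℕ) : ZMod m) := by
      rw [ZMod.isUnit_iff_coprime]
      exact hp1
    have hcast : ((p - 1 : ℕ) : ZMod m) = (p : ZMod m) - 1 := by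
      rw [Nat.cast_sub (by omega), Nat.cast_one]
    have h0 : ((p - 1 : ℕ) : ZMod m) * ((p : ZMod m) * A) = 0 := by
      rw [hcast]
      linear_combination (p : ZMod m) * h + (p : ZMod m) * hfj + (j₀ : ZMod m) * hpe
    rw [hu.mul_right_eq_zero] at h0
    exact hA h0
  -- the conclusion, once `{u₁, u₂} = {f j₀, -pA}`
  have hgoal : ({u₁, u₂} : Multiset (ZMod m)) = {f j₀, -((p : ZMod m) * A)} →
      F + {u₁, u₂} = (Multiset.range p).map f + {-((p : ZMod m) * A)} := by
    intro h
    rw [h, hsplit, Multiset.insert_eq_cons, Multiset.add_cons, Multiset.cons_add]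
  rcases exists_pairing_of_four hm ht with ⟨-, h2⟩ | ⟨h1, h2⟩ | ⟨h1, h2⟩
  · exact (hbad h2).elim
  · rw [hsu]
    apply hgoal
    rw [show u₁ = f j₀ by linear_combination h1,
      show u₂ = -((p : ZMod m) * A) by linear_combination h2]
  · rw [hsu]
    apply hgoal
    rw [show u₁ = -((p : ZMod m) * A) by linear_combination h1,
      show u₂ = f j₀ by linear_combination h2, Multiset.pair_comm]

/-! ### The registered stub -/

/-- **GP-L3 `stub_sigmaStd_of_fibre` — `p₁ - 1` points of a `p₁`-progression force `σ_{p₁,A}`.** For a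
prime `p₁ ≥ 5` and a level `m` all of whose prime factors are `≥ p₁`, `p₁ ∣ m`: if a Hodge multiset `s` of
`p₁ + 1` elements contains all but one of the `p₁` points `A + j(m/p₁)` (`p₁A ≠ 0`), then `s` is a
juxtaposition of pairs or `s = {A + j(m/p₁) : j < p₁} + {-p₁A}`: `(m, 6) = 1` and `(p₁ - 1, m) = 1` (the
primes `2, 3` and the prime factors of `p₁ - 1` are `< p₁`), the standard multiset `σ_{p₁,A}` is Hodge
(`isHodgeMultiset_pStandard`, `p₁ = 2r + 1` odd), the progression is the fibre of reduction mod `m/p₁` (no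
repetition), `p₁ · (m/p₁) = 0`, and `eq_sigmaStd_of_fibre` applies (the right disjunct always holds).
[cite: AokiShioda1983, §2 Theorem (𝔅²ₘ) (i)] [cite: Aoki1987, §1 p. 387] -/
theorem stub_sigmaStd_of_fibre : ∀ (p₁ : ℕ), p₁.Prime → 5 ≤ p₁ → ∀ (m : ℕ) [NeZero m], (∀ q ∈ m.primeFactors, p₁ ≤ q) → p₁ ∣ m → ∀ s : Multiset (ZMod m), IsHodgeMultiset s → Multiset.card s = p₁ + 1 → ∀ A : ZMod m, (p₁ : ZMod m) * A ≠ 0 → (∃ j₀ : ℕ, j₀ < p₁ ∧ ∀ j : ℕ, j < p₁ → j ≠ j₀ → A + (j : ZMod m) * ((m / p₁ : ℕ) : ZMod m) ∈ s) → (∃ Q : Multiset (ZMod m), (∀ a ∈ Q, a ≠ 0) ∧ s = Q + Q.map (fun a ↦ -a)) ∨ s = (Multiset.range p₁).map (fun i : ℕ ↦ A + (i : ZMod m) * ((m / p₁ : ℕ) : ZMod m)) + {-((p₁ : ZMod m) * A)} := by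
  intro p₁ hp₁ hp5 m _ hq hpm s hs hcard A hA hfib
  obtain ⟨j₀, hj₀, hfib⟩ := hfib
  right
  -- every prime factor of `m` is `≥ p₁ ≥ 5`: `(m, 6) = 1` and `(p₁ - 1, m) = 1`
  have hprime : ∀ q : ℕ, q.Prime → q ∣ m → p₁ ≤ q := fun q hq' hqm ↦
    hq q (Nat.mem_primeFactors.mpr ⟨hq', hqm, NeZero.ne m⟩)
  have hm6 : m.Coprime 6 := by
    have h2 : m.Coprime 2 :=
      ((Nat.Prime.coprime_iff_not_dvd Nat.prime_two).mpr fun h ↦ by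
        have := hprime 2 Nat.prime_two h; omega).symm
    have h3 : m.Coprime 3 :=
      ((Nat.Prime.coprime_iff_not_dvd Nat.prime_three).mpr fun h ↦ by
        have := hprime 3 Nat.prime_three h; omega).symm
    rw [show (6 : ℕ) = 2 * 3 from rfl]
    exact Nat.Coprime.mul_right h2 h3
  have hp1m : (p₁ - 1).Coprime m := Nat.coprime_of_dvd fun k hk hk1 hkm ↦ by
    have h1 := hprime k hk hkm
    have h2 : k ≤ p₁ - 1 := Nat.le_of_dvd (by omega) hk1
    omega
  -- the standard multiset `σ_{p₁,A}` is Hodge and its progression has no repetition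
  have he : (p₁ : ZMod m) * ((m / p₁ : ℕ) : ZMod m) = 0 := by
    rw [← Nat.cast_mul, Nat.mul_div_cancel' hpm, ZMod.natCast_self]
  obtain ⟨r, hr⟩ := hp₁.odd_of_ne_two (by omega)
  have hσ : IsHodgeMultiset ((Multiset.range p₁).map (fun i : ℕ ↦ A + (i : ZMod m) * ((m / p₁ : ℕ) : ZMod m)) +
      {-((p₁ : ZMod m) * A)}) :=
    isHodgeMultiset_pStandard hr hpm hA
  have hnd : ((Multiset.range p₁).map (fun i : ℕ ↦ A + (i : ZMod m) * ((m / p₁ : ℕ) : ZMod m))).Nodup := by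
    rw [range_map_eq_filter_of_dvd_one hpm A]
    exact Finset.nodup _
  exact eq_sigmaStd_of_fibre hm6 hp1m hs hcard hA he hσ hnd hj₀ hfib

end Summit.HodgeConjecture.HodgeConjecture.Theorems.CancelByAnyClaimLattice.CoprimeSix

end
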